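import Summits.RiemannHypothesis.RiemannHypothesis.Theses.SpectralTrace
import HarnessLib

/-!
# `UndressingPrinciple` is false modulo a critical dressed configuration

Negative lemma for the crux `stmt-RiemannHypothesis-17980`
(`Summit.RiemannHypothesis.RiemannHypothesis.Theses.SpectralTrace.UndressingPrinciple`, route
`SpectralTrace`), filed by the crux-attack refuter.

`CriticalDressedConfiguration` packages the hypotheses H1–H7 of the crux VERBATIM together with a
*witness of non-undressability*: a sequence of half-window Weil tests `h n` along which the
positivity form degenerates (`Re S(h n ⋆ h̃ n) → 0`) while their transforms stay bounded below off a
real set `Z`, and one window test `g` whose transform vanishes on `Z ∖ {±z₀}`, takes the same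
non-zero value at `±z₀`, and whose `S g` is not a natural multiple of that value.  The theorem
`UndressingPrinciple_false_of_CriticalDressedConfiguration` is the kernel-checked implication: any
real family reproducing `S` on the window would be supported on `Z` (term ≤ sum for the non-negative
autocorrelation family, `weilMellin_weilConv_weilReflect_half`) and would then give
`S g = (#atoms at ±z₀) · ĝ(z₀)`, an integrality that the witness denies.

WHY `CriticalDressedConfiguration` is not constructed here (paper construction, refuter folder
ATTACK.md §5 and kit jobs j025015 / j027269): take the lattice sea `2πℤ/log 2` (Parseval on the
half window gives `Σ_k |ĥ(λ_k)|² = log 2 · ‖h‖²`), `M = 61` dressed quadruples `±β ± 250 i` and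
undressed filler atoms at the real zeros of the kernel test (to meet Riemann–von Mangoldt); the
positivity form is `log 2‖h‖² + 4M⟨h,c⟩² − 4M⟨h,r⟩²` per parity sector, non-negative iff a 2×2
Schur complement is ≤ 1, critical at `β* ≈ 0.44948 < 1/2` with closed-form kernel
`r − κ c` (`r = sinh(β t) sin(250 t)`, `c = cosh(β t) cos(250 t)`); Poisson summation and the
Euler–Lagrange identity make the forced mass at a zero pair `±z₀` a closed-form number,
`F(250.00001) = 4M + 3.5866…`, `F(237.078) = 2.0934…`, not integers.  Its Lean construction needs
Parseval/Poisson on the window, the cut-off approximation and validated numerics for two roots — a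
construction item, not a refuter's scratch file.
-/

noncomputable section

open Complex Set Filter Topology

namespace Summit.RiemannHypothesis.RiemannHypothesis.Theorems.UndressingPrinciple.Negative

open Literature.NumberTheory.LFunctions

/-- [topic RiemannHypothesis/SpectralTrace/UndressingPrinciple] A CRITICAL DRESSED CONFIGURATION:
data `(ι₀, γ, b, S)` satisfying hypotheses H1–H7 of `UndressingPrinciple` verbatim, plus a witness
that no real family reproduces `S` on the window `[-log 2, log 2]`: half-window Weil tests `h n`
with `Re S(h n ⋆ h̃ n) → 0` whose transforms are eventually bounded below at every real point
outside `Z`, and a window Weil test `g` with `ĝ = 0` on `Z ∖ {z₀, -z₀}`, `ĝ(-z₀) = ĝ(z₀) ≠ 0` and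
`S g ∉ ℕ · ĝ(z₀)`.  Paper instance: lattice sea `2πℤ/log 2` + 61 dressed quadruples `±β* ± 250i`
at the exact positivity margin + filler at the kernel zeros (module docstring). -/
def CriticalDressedConfiguration : Prop :=
  ∃ (ι₀ : Type) (γ b : ι₀ → ℝ) (S : (ℝ → ℂ) → ℂ),
    (∀ i, |b i| < 1 / 2) ∧ (∀ i, |γ i| ≤ 100 → b i = 0) ∧
    (∃ e : ι₀ ≃ ι₀, ∀ i, γ (e i) = -γ i ∧ b (e i) = b i) ∧
    (∃ e : ι₀ ≃ ι₀, ∀ i, γ (e i) = γ i ∧ b (e i) = -b i) ∧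
    (∃ C T₀ : ℝ, ∀ T : ℝ, T₀ ≤ T → {i : ι₀ | |γ i| ≤ T}.Finite ∧
      |(({i : ι₀ | |γ i| ≤ T}.ncard : ℕ) : ℝ) -
        2 * (T / (2 * Real.pi) * Real.log (T / (2 * Real.pi)) - T / (2 * Real.pi))| ≤
        C * Real.log T) ∧
    (∀ g : ℝ → ℂ, IsWeilTest g →
      HasSum (fun i => weilMellin g (1 / 2 + (b i : ℂ) + (γ i : ℂ) * Complex.I)) (S g)) ∧
    (∀ h : ℝ → ℂ, IsWeilTest h → tsupport h ⊆ Set.Icc (-(Real.log 2 / 2)) (Real.log 2 / 2) →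
      0 ≤ (S (weilConv h (weilReflect h))).re) ∧
    ∃ (Z : Set ℝ) (z₀ : ℝ) (g : ℝ → ℂ) (h : ℕ → ℝ → ℂ),
      (∀ n, IsWeilTest (h n)) ∧
      (∀ n, tsupport (h n) ⊆ Set.Icc (-(Real.log 2 / 2)) (Real.log 2 / 2)) ∧
      Tendsto (fun n => (S (weilConv (h n) (weilReflect (h n)))).re) atTop (𝓝 0) ∧
      (∀ x : ℝ, x ∉ Z → ∃ ε : ℝ, 0 < ε ∧
        ∀ᶠ n in atTop, ε ≤ ‖weilMellin (h n) (1 / 2 + (x : ℂ) * Complex.I)‖ ^ 2) ∧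
      IsWeilTest g ∧ tsupport g ⊆ Set.Icc (-Real.log 2) (Real.log 2) ∧
      (∀ x ∈ Z, x ≠ z₀ → x ≠ -z₀ → weilMellin g (1 / 2 + (x : ℂ) * Complex.I) = 0) ∧
      weilMellin g (1 / 2 + ((-z₀ : ℝ) : ℂ) * Complex.I) =
        weilMellin g (1 / 2 + (z₀ : ℂ) * Complex.I) ∧
      weilMellin g (1 / 2 + (z₀ : ℂ) * Complex.I) ≠ 0 ∧
      ∀ n : ℕ, S g ≠ (n : ℂ) * weilMellin g (1 / 2 + (z₀ : ℂ) * Complex.I)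

/-- Term ≤ sum for the autocorrelation family: if a real family `γ'` reproduces `S` on the window
tests, then for every half-window Weil test `h` and every index `j`,
`‖ĥ(1/2 + iγ'_j)‖² ≤ Re S(h ⋆ h̃)`. [folklore] -/
theorem normSq_weilMellin_le_re {S : (ℝ → ℂ) → ℂ} {ι : Type} {γ' : ι → ℝ}
    (hrep : ∀ g : ℝ → ℂ, IsWeilTest g → tsupport g ⊆ Set.Icc (-Real.log 2) (Real.log 2) →
      HasSum (fun j => weilMellin g (1 / 2 + (γ' j : ℂ) * Complex.I)) (S g))
    {h : ℝ → ℂ} (hh : IsWeilTest h)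
    (hs : tsupport h ⊆ Set.Icc (-(Real.log 2 / 2)) (Real.log 2 / 2)) (j : ι) :
    ‖weilMellin h (1 / 2 + (γ' j : ℂ) * Complex.I)‖ ^ 2 ≤
      (S (weilConv h (weilReflect h))).re := by
  have hk : IsWeilTest (weilConv h (weilReflect h)) := hh.weilConv hh.weilReflect
  have hks : tsupport (weilConv h (weilReflect h)) ⊆ Set.Icc (-Real.log 2) (Real.log 2) := by
    have := tsupport_weilConv_weilReflect_subset (a := Real.log 2 / 2) hh.2 hs
    convert this using 2 <;> ring
  have hsumC := hrep _ hk hks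
  have hsumC' :
      HasSum (fun j => (((‖weilMellin h (1 / 2 + (γ' j : ℂ) * Complex.I)‖ ^ 2 : ℝ) : ℂ)))
        (S (weilConv h (weilReflect h))) := by
    simpa only [weilMellin_weilConv_weilReflect_half hh] using hsumC
  have hsumR : HasSum (fun j => ‖weilMellin h (1 / 2 + (γ' j : ℂ) * Complex.I)‖ ^ 2)
      (S (weilConv h (weilReflect h))).re := by
    simpa only [Complex.reCLM_apply, Complex.ofReal_re] using hsumC'.mapL Complex.reCLM
  exact le_hasSum hsumR j fun k _ => by positivity

/-- A `HasSum` family that is a non-zero constant `v` on a set `J` and `0` elsewhere has `J`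
finite and sum `#J · v`. [folklore] -/
theorem hasSum_const_on_eq {ι : Type} {J : Set ι} [DecidablePred (· ∈ J)] {v a : ℂ}
    (hv : v ≠ 0) (hsum : HasSum (fun j => if j ∈ J then v else 0) a) :
    ∃ hJ : J.Finite, a = (hJ.toFinset.card : ℂ) * v := by
  have h0 := hsum.summable.tendsto_cofinite_zero
  have hev : ∀ᶠ j in cofinite, ‖(if j ∈ J then v else 0 : ℂ)‖ < ‖v‖ := by
    have : Metric.ball (0 : ℂ) ‖v‖ ∈ 𝓝 (0 : ℂ) := Metric.ball_mem_nhds 0 (norm_pos_iff.mpr hv)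
    filter_upwards [h0.eventually this] with j hj
    simpa using hj
  have hfin : {j | ¬ ‖(if j ∈ J then v else 0 : ℂ)‖ < ‖v‖}.Finite :=
    Filter.eventually_cofinite.mp hev
  have hJ : J.Finite := hfin.subset fun j hj => by
    have hj' : j ∈ J := hj
    simp [hj']
  refine ⟨hJ, ?_⟩
  have hsum' : HasSum (fun j => if j ∈ J then v else 0) (∑ j ∈ hJ.toFinset, v) := by
    have h1 : HasSum (fun j => if j ∈ J then v else 0)
        (∑ j ∈ hJ.toFinset, (if j ∈ J then v else 0)) :=
      hasSum_sum_of_ne_finset_zero fun j hj => by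
        have : j ∉ J := by simpa using hj
        simp [this]
    have h2 : (∑ j ∈ hJ.toFinset, (if j ∈ J then v else 0 : ℂ)) = ∑ j ∈ hJ.toFinset, v :=
      Finset.sum_congr rfl fun j hj => by
        have : j ∈ J := by simpa using hj
        simp [this]
    simpa only [h2] using h1
  rw [hsum.unique hsum', Finset.sum_const, nsmul_eq_mul]

/-- NEGATIVE LEMMA (¬ crux modulo the witness): a critical dressed configuration refutes the
Undressing Principle.  Proof: instantiate the principle at the configuration; every atom `γ'_j` of
the undressed family lies in `Z` (else `ε ≤ ‖ĥ_n(γ'_j)‖² ≤ Re S(h_n ⋆ h̃_n) → 0`); then the window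
test `g` sees only the atoms at `±z₀`, all with the same value `ĝ(z₀) ≠ 0`, so summability makes
them finitely many and `S g = (#atoms) · ĝ(z₀)`, contradicting the last clause. -/
theorem UndressingPrinciple_false_of_CriticalDressedConfiguration :
    CriticalDressedConfiguration →
      ¬ Summit.RiemannHypothesis.RiemannHypothesis.Theses.SpectralTrace.UndressingPrinciple := by
  rintro ⟨ι₀, γ, b, S, h1, h2, h3, h4, h5, h6, h7, Z, z₀, g, h, hW, hS, hQ, hZ, gW, gS, gZ, geven,
    gne, gnat⟩ hUP
  obtain ⟨ι, γ', hrep⟩ := hUP ι₀ γ b S h1 h2 h3 h4 h5 h6 h7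
  -- Step 1: the undressed family is supported on `Z`.
  have hmem : ∀ j, γ' j ∈ Z := by
    intro j
    by_contra hj
    obtain ⟨ε, hε, hev⟩ := hZ (γ' j) hj
    have hle : ∀ n, ‖weilMellin (h n) (1 / 2 + (γ' j : ℂ) * Complex.I)‖ ^ 2 ≤
        (S (weilConv (h n) (weilReflect (h n)))).re :=
      fun n => normSq_weilMellin_le_re hrep (hW n) (hS n) j
    have ht : Tendsto (fun n => ‖weilMellin (h n) (1 / 2 + (γ' j : ℂ) * Complex.I)‖ ^ 2)
        atTop (𝓝 0) :=
      squeeze_zero (fun n => by positivity) hle hQ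
    obtain ⟨n, hn1, hn2⟩ := ((ht.eventually (gt_mem_nhds hε)).and hev).exists
    exact absurd hn2 (not_le.mpr hn1)
  -- Step 2: on the window test `g` only the atoms at `±z₀` are seen, all with value `ĝ(z₀)`.
  classical
  set v : ℂ := weilMellin g (1 / 2 + (z₀ : ℂ) * Complex.I) with hv
  have hfam : (fun j => weilMellin g (1 / 2 + (γ' j : ℂ) * Complex.I)) =
      fun j => if j ∈ {j | γ' j = z₀ ∨ γ' j = -z₀} then v else 0 := by
    funext j
    by_cases hj : γ' j = z₀ ∨ γ' j = -z₀
    · rw [if_pos (show j ∈ {j | γ' j = z₀ ∨ γ' j = -z₀} from hj)]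
      rcases hj with hj | hj
      · rw [hj]
      · rw [hj]; exact geven
    · rw [if_neg (show j ∉ {j | γ' j = z₀ ∨ γ' j = -z₀} from hj)]
      obtain ⟨hj1, hj2⟩ := not_or.mp hj
      exact gZ _ (hmem j) hj1 hj2
  have hsum := hrep g gW gS
  rw [hfam] at hsum
  obtain ⟨hJ, hval⟩ := hasSum_const_on_eq gne hsum
  exact gnat _ hval

end Summit.RiemannHypothesis.RiemannHypothesis.Theorems.UndressingPrinciple.Negative

end
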